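import Literature.AnabelianGeometry.SemiGraphs.MetabelianLeafStarEscape
import Literature.AnabelianGeometry.SemiGraphs.TemperedThm37OfNoCore
import HarnessLib

/-!
# [SemiAnbd] Cor 3.9 (R3c) and Thm 3.7 (iii) sentences 2–3 / (iv) criteria HOLD at the RAYLESS star `𝒢⋆(p)`,
# where Thm 3.7 (iii) sentence 1 FAILS (proof-only, by name)

Mochizuki, *Semi-graphs of anabelioids*, Publ. RIMS **42** (2006), §3: Theorem 3.7 (iii) pp. 40–41 ("any compact
subgroup of `π₁^temp(𝒢)` is contained in a verticial subgroup; if a nontrivial compact subgroup is contained in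
more than one verticial subgroup, then it is contained in precisely two verticial subgroups … [and] in the image of
some `π̂₁(𝒢_e)`"), Theorem 3.7 (iv) p. 41, and Corollary 3.9 p. 42 (hypotheses: "connected, countable,
quasi-coherent, totally elevated, totally estranged, verticially slim graphs of anabelioids"), proof p. 43 l. 13
"[again by Theorem 3.7, (iii), (iv)]" — the step the cell names (R3c) `EdgeLikeCentralizerAt`, FACT-LIST rows
F-2772 / F-2773 [cite: MochizukiSemiAnbd2006, Cor 3.9 p.42].

PROOF-ONLY file (abc-iut cell, layer L3, row «COR39-R3c@RAYLESS-STAR», seat abc-iut-w6-d064 gen 7; no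
definition, no named fact, no custody file touched; the sequel abc-iut-L3-lead γ58 (A) named for the RAYLESS-STAR
row of abc-iut-L3-t8).  The carrier is abc-iut-L3-t8's `metabelianLeafStar p` (`𝒢⋆(p)`: the star of infinite
valence, centre `F̂₂` free pro-`p` of rank two, leaves the Iwahori-type groups, edge groups `ℤ_p`; underlying
semi-graph `SemiGraph.leafStar`, NOT locally finite, universal covering rayless), at which abc-iut-L3-t8 gen 6
refuted the ∀-countable typing of Thm 3.7 (iii), first sentence (`metabelianLeafStar_not_compactInVerticialAt`,
`MetabelianLeafStarEscape.lean`).  Here, BY NAME through abc-iut-f-176's no-core package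
(`TemperedHbddOfNoCore.lean`, `TemperedThm37OfNoCore.lean`):

* `SemiGraph.leafStar_noCore` — the leaf-star has NO infinitely-branching core (the displayed clause `hNC` of the
  package: every non-empty set of vertices has a member with finitely many branches toward the set), via the rank
  criterion `SemiGraph.noCore_of_rank` with ranks «leaf ↦ 0, centre ↦ 1» (`leafStar_towardHigherRank_finite`: a
  leaf has valence one; every edge at the centre ends at a leaf, of lower rank);
* `metabelianLeafStar_cor39Hypotheses` — `𝒢⋆(p)` satisfies the hypotheses of Cor 3.9 (Thm 3.7's, abc-iut-L3-t8's
  `metabelianLeafStar_thm37Hypotheses'`, plus "graph": `starOfLeaves_isGraph`);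
* `metabelianLeafStar_centralizer_le_verticial` (compact-centraliser sentence of the proof of Cor 3.9 p. 43),
  `metabelianLeafStar_edgeLikeCentralizerAt` (F-2772 `EdgeLikeCentralizerAt 𝒢⋆(p) c`, EVERY chart, hypothesis-free),
  `metabelianLeafStar_compactInTwoVerticial` (Thm 3.7 (iii) sentences 2–3), `metabelianLeafStar_mem_verticial_of_le_conj_conj`
  (triple-conjugate criterion, Thm 3.7 (iv)), `metabelianLeafStar_normalizer_le_verticial`,
  `metabelianLeafStar_commensurator_eq_of_mem_edgeLikeSubgroups` (edge-like subgroups commensurably terminal);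
* `metabelianLeafStar_not_forall_exists_verticial` — so at `𝒢⋆(p)` it is EXACTLY the existence sentence of
  Thm 3.7 (iii) that fails (`compactInVerticialAt_iff_exists_verticial_of_noCore`), and
  `metabelianLeafStar_edgeLikeCentralizerAt_and_not_compactInVerticialAt` — (R3c) HOLDS while Thm 3.7 (iii)
  sentence 1 FAILS, at a carrier that is NOT locally finite (`not_isLocallyFinite`): the locally finite producers
  (`edgeLikeCentralizerAt_of_isLocallyFinite`, which carried the same conjunction at the ray `𝒢_θ`,
  `ThetaRayCor39.lean`) are silent here; `not_forall_cor39Hypotheses_not_isLocallyFinite_compactInVerticialAt`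
  records the ∀-negation in the non-locally-finite class.

Honest framing: typing bookkeeping about the cell's ∀-countable statements at OUR carrier `𝒢⋆(p)`; outside the
[IUTchIII] Cor 3.12 cone (every print consumer of Cor 3.9 / Thm 3.7 has a finite dual graph, where all of the above
are kernel theorems); nothing printed is refuted; no side taken on [IUTchIII] Cor 3.12; typed ≠ proved.
-/

noncomputable section

namespace Literature.AnabelianGeometry.SemiGraphs

/-! ### The leaf-star has no infinitely-branching core -/

namespace SemiGraph

/-- **Rank clause for the leaf-star** (ranks: leaf `↦ 0`, centre `↦ 1`): every vertex of `𝔾⋆` has only finitely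
many branches whose edge's other branch abuts a vertex of equal or higher rank — at a leaf the whole star is the
singleton `{β_n⁻}`; at the centre every branch `β_n⁺` is paired with `β_n⁻`, which abuts the leaf `n` of LOWER rank,
so the set is empty. [cite: MochizukiSemiAnbd2006, §1 p.11] -/
theorem leafStar_towardHigherRank_finite (w : leafStar.Vertex) :
    {b : leafStar.Branch | leafStar.abuts b = some w ∧ ∃ b', b' ≠ b ∧ leafStar.edgeOf b' = leafStar.edgeOf b ∧
      ∃ w', leafStar.abuts b' = some w' ∧
        (fun v : Option ℕ => (if v.isSome then 0 else 1 : ℕ)) w ≤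
          (fun v : Option ℕ => (if v.isSome then 0 else 1 : ℕ)) w'}.Finite := by
  cases w with
  | some n =>
    -- at a leaf: contained in the (singleton) star of the leaf
    exact (leafStar_finite_star_some n).subset fun b hb => hb.1
  | none =>
    -- at the centre: empty
    convert Set.finite_empty
    ext b
    simp only [Set.mem_setOf_eq, Set.mem_empty_iff_false, iff_false, not_and]
    rintro hb ⟨b', hb'b, hb'e, w', hb'w, hle⟩
    -- `b = (b.1, true)`, so the other branch of its edge is `b' = (b.1, false)`, abutting the leaf `b.1`
    have hbt : b = (b.1, true) := leafStar_abuts_eq_some_none_iff.mp hb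
    have hb'f : b' = (b.1, false) := by
      obtain ⟨e', c'⟩ := b'
      have he : e' = b.1 := hb'e
      subst he
      cases c' with
      | false => rfl
      | true => exact absurd hbt.symm hb'b
    subst hb'f
    change some (some b.1) = some w' at hb'w
    have hw' : w' = some b.1 := (Option.some_injective _ hb'w).symm
    subst hw'
    simp at hle

/-- **The leaf-star `𝔾⋆` has NO infinitely-branching core**: every non-empty set `S` of vertices has a member with
only finitely many branches whose edge has another branch abutting a vertex of `S` — the displayed hypothesis `hNC`
of abc-iut-f-176's no-core package (`TemperedHbddOfNoCore.lean`), here from its rank criterion `noCore_of_rank`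
with the ranks «leaf ↦ 0, centre ↦ 1» (`leafStar_towardHigherRank_finite`). [cite: MochizukiSemiAnbd2006, §1 p.11] -/
theorem leafStar_noCore :
    ∀ S : Set leafStar.Vertex, S.Nonempty → ∃ w ∈ S,
      {b : leafStar.Branch | leafStar.abuts b = some w ∧ ∃ b', b' ≠ b ∧ leafStar.edgeOf b' = leafStar.edgeOf b ∧
        ∃ w' ∈ S, leafStar.abuts b' = some w'}.Finite :=
  noCore_of_rank leafStar (fun v : Option ℕ => (if v.isSome then 0 else 1 : ℕ)) leafStar_towardHigherRank_finite

end SemiGraph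

/-! ### At `𝒢⋆(p)` -/

namespace ProfiniteSemiGraph

open Topology

variable (p : ℕ) [hp : Fact p.Prime]

/-- **`𝒢⋆(p)` has no infinitely-branching core** (its underlying semi-graph is the leaf-star, `starOfLeaves_graph`):
the clause `hNC` of the no-core package at the carrier. [cite: MochizukiSemiAnbd2006, §1 p.11] -/
theorem metabelianLeafStar_noCore :
    ∀ S : Set (metabelianLeafStar p).graph.Vertex, S.Nonempty → ∃ w ∈ S,
      {b : (metabelianLeafStar p).graph.Branch | (metabelianLeafStar p).graph.abuts b = some w ∧
        ∃ b', b' ≠ b ∧ (metabelianLeafStar p).graph.edgeOf b' = (metabelianLeafStar p).graph.edgeOf b ∧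
          ∃ w' ∈ S, (metabelianLeafStar p).graph.abuts b' = some w'}.Finite :=
  SemiGraph.leafStar_noCore

/-- **`𝒢⋆(p)` satisfies the hypotheses of [SemiAnbd] Cor 3.9** ("connected, countable, quasi-coherent, totally
elevated, totally estranged, verticially slim graphs of anabelioids", with Galois-countability and a vertex as in
`Prop36Hypotheses`): `Thm37Hypotheses` by abc-iut-L3-t8's `metabelianLeafStar_thm37Hypotheses'`, and the leaf-star is
a graph (`starOfLeaves_isGraph`). [cite: MochizukiSemiAnbd2006, Cor 3.9 p.42] -/
theorem metabelianLeafStar_cor39Hypotheses : Cor39Hypotheses (metabelianLeafStar p) where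
  toProp36Hypotheses := (metabelianLeafStar_thm37Hypotheses' p).toProp36Hypotheses
  isTotallyEstranged := (metabelianLeafStar_thm37Hypotheses' p).isTotallyEstranged
  isGraph := (metabelianLeafStar_isConnected_isCountable_hasVertex p).2.2.2.1

/-- **Compact-centraliser sentence at `𝒢⋆(p)`, every chart** (proof of Cor 3.9 p. 43 l. 13 "[again by Theorem 3.7,
(iii), (iv)]"): the centraliser of a non-trivial compact subgroup `C` of `π₁^temp(𝒢⋆(p))` lies in every verticial
subgroup containing `C` — abc-iut-f-176's `centralizer_le_verticial_of_noCore` at the carrier, hypothesis-free.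
[cite: MochizukiSemiAnbd2006, Cor 3.9 p.43] -/
theorem metabelianLeafStar_centralizer_le_verticial (c : TemperedPiChart (metabelianLeafStar p))
    (C : Subgroup c.G) (hCc : IsCompact (C : Set c.G)) (hC : C ≠ ⊥)
    {v : (metabelianLeafStar p).graph.Vertex} {H : Subgroup c.G} (hH : H ∈ verticialSubgroups c v) (hCH : C ≤ H) :
    Subgroup.centralizer (C : Set c.G) ≤ H :=
  (metabelianLeafStar p).centralizer_le_verticial_of_noCore (metabelianLeafStar_thm37Hypotheses' p)
    (metabelianLeafStar_noCore p) c C hCc hC hH hCH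

/-- **F-2772 `EdgeLikeCentralizerAt 𝒢⋆(p) c` HOLDS at EVERY chart, hypothesis-free** ((R3c): the centraliser of
the image `ψ(U)` of an open `U ⊆ Π_e` under an edge homomorphism at `e` lies in every verticial subgroup containing
it) — abc-iut-f-176's `edgeLikeCentralizerAt_of_noCore` at the carrier.  The locally finite / tame-with-finite-valence
producers do not reach `𝒢⋆(p)` (`(metabelianLeafStar_isConnected_isCountable_hasVertex p).2.2.2.2`: NOT locally
finite). [cite: MochizukiSemiAnbd2006, Cor 3.9 p.43] -/
theorem metabelianLeafStar_edgeLikeCentralizerAt (c : TemperedPiChart (metabelianLeafStar p)) :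
    EdgeLikeCentralizerAt (metabelianLeafStar p) c :=
  edgeLikeCentralizerAt_of_noCore (metabelianLeafStar_cor39Hypotheses p) (metabelianLeafStar_noCore p) c

/-- **[SemiAnbd] Thm 3.7 (iii), second and third sentences, HOLD at `𝒢⋆(p)`, every chart**: a compact `C ≠ 1` of
`π₁^temp(𝒢⋆(p))` lying in two distinct verticial subgroups lies in precisely these two and in an edge-like subgroup
of a closed edge — abc-iut-f-176's `compactInTwoVerticial_of_noCore` at the carrier (while the FIRST sentence fails
there, `metabelianLeafStar_not_compactInVerticialAt`). [cite: MochizukiSemiAnbd2006, Thm 3.7(iii) pp.40-41] -/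
theorem metabelianLeafStar_compactInTwoVerticial (c : TemperedPiChart (metabelianLeafStar p))
    (C : Subgroup c.G) (hCc : IsCompact (C : Set c.G)) (hC : C ≠ ⊥)
    {v₁ v₂ : (metabelianLeafStar p).graph.Vertex} {H₁ H₂ : Subgroup c.G} (hH₁ : H₁ ∈ verticialSubgroups c v₁)
    (hH₂ : H₂ ∈ verticialSubgroups c v₂) (hne : H₁ ≠ H₂) (hC₁ : C ≤ H₁) (hC₂ : C ≤ H₂) :
    (∀ (v₃ : (metabelianLeafStar p).graph.Vertex) (H₃ : Subgroup c.G), H₃ ∈ verticialSubgroups c v₃ → C ≤ H₃ →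
        H₃ = H₁ ∨ H₃ = H₂) ∧
      ∃ (e : (metabelianLeafStar p).graph.Edge) (L : Subgroup c.G), (metabelianLeafStar p).graph.IsClosedEdge e ∧
        L ∈ edgeLikeSubgroups c e ∧ C ≤ L :=
  (metabelianLeafStar p).compactInTwoVerticial_of_noCore (metabelianLeafStar_thm37Hypotheses' p)
    (metabelianLeafStar_noCore p) c C hCc hC hH₁ hH₂ hne hC₁ hC₂

/-- **TRIPLE-CONJUGATE CRITERION at `𝒢⋆(p)`, every chart** (Thm 3.7 (iv) p. 41): a compact `K ≠ 1` in a verticial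
`H`, in `gHg⁻¹` and in `g²Hg⁻²` forces `g ∈ H` — abc-iut-f-176's `mem_verticial_of_le_conj_conj_of_noCore` at the
carrier. [cite: MochizukiSemiAnbd2006, Thm 3.7(iv) p.41] -/
theorem metabelianLeafStar_mem_verticial_of_le_conj_conj (c : TemperedPiChart (metabelianLeafStar p))
    {v : (metabelianLeafStar p).graph.Vertex} {H : Subgroup c.G} (hH : H ∈ verticialSubgroups c v)
    (K : Subgroup c.G) (hKc : IsCompact (K : Set c.G)) (hK : K ≠ ⊥) (hKH : K ≤ H) (g : c.G)
    (hKg : ∀ k ∈ K, ∃ h ∈ H, g * h * g⁻¹ = k) (hKg₂ : ∀ k ∈ K, ∃ h ∈ H, (g * g) * h * (g * g)⁻¹ = k) : g ∈ H :=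
  (metabelianLeafStar p).mem_verticial_of_le_conj_conj_of_noCore (metabelianLeafStar_thm37Hypotheses' p)
    (metabelianLeafStar_noCore p) c hH K hKc hK hKH g hKg hKg₂

/-- **Normalisers of non-trivial compact subgroups at `𝒢⋆(p)`, every chart**: `N(C) ≤ H` for every verticial `H ⊇ C`
— abc-iut-f-176's `normalizer_le_verticial_of_noCore` at the carrier. [cite: MochizukiSemiAnbd2006, Thm 3.7(iv) p.41] -/
theorem metabelianLeafStar_normalizer_le_verticial (c : TemperedPiChart (metabelianLeafStar p))
    (C : Subgroup c.G) (hCc : IsCompact (C : Set c.G)) (hC : C ≠ ⊥)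
    {v : (metabelianLeafStar p).graph.Vertex} {H : Subgroup c.G} (hH : H ∈ verticialSubgroups c v) (hCH : C ≤ H) :
    Subgroup.normalizer (C : Set c.G) ≤ H :=
  (metabelianLeafStar p).normalizer_le_verticial_of_noCore (metabelianLeafStar_thm37Hypotheses' p)
    (metabelianLeafStar_noCore p) c C hCc hC hH hCH

/-- **Edge-like subgroups of `π₁^temp(𝒢⋆(p))` are commensurably terminal, every chart** (`C(L) = L`; Thm 3.7 (iv)
p. 41 with §5 p. 65) — abc-iut-f-176's `commensurator_eq_of_mem_edgeLikeSubgroups_of_noCore` at the carrier.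
[cite: MochizukiSemiAnbd2006, Thm 3.7(iv) p.41] -/
theorem metabelianLeafStar_commensurator_eq_of_mem_edgeLikeSubgroups (c : TemperedPiChart (metabelianLeafStar p))
    {e : (metabelianLeafStar p).graph.Edge} {L : Subgroup c.G} (hL : L ∈ edgeLikeSubgroups c e) :
    Subgroup.Commensurable.commensurator L = L :=
  (metabelianLeafStar p).commensurator_eq_of_mem_edgeLikeSubgroups_of_noCore (metabelianLeafStar_thm37Hypotheses' p)
    (metabelianLeafStar_isConnected_isCountable_hasVertex p).2.2.2.1 (metabelianLeafStar_noCore p) c hL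

/-! ### Which sentence of Thm 3.7 (iii) fails at `𝒢⋆(p)`, and the (R3c) conjunction -/

/-- **At `𝒢⋆(p)` it is EXACTLY the existence sentence of Thm 3.7 (iii) that fails**: NOT every compact subgroup of
`π₁^temp(𝒢⋆(p))` (some chart) lies in a verticial subgroup — abc-iut-L3-t8's refutation
`metabelianLeafStar_not_compactInVerticialAt` pushed through abc-iut-f-176's
`compactInVerticialAt_iff_exists_verticial_of_noCore` (the uniqueness / edge conjunct being a theorem there,
`metabelianLeafStar_compactInTwoVerticial`). [cite: MochizukiSemiAnbd2006, Thm 3.7(iii) pp.40-41] -/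
theorem metabelianLeafStar_not_forall_exists_verticial :
    ¬ ∀ (c : TemperedPiChart (metabelianLeafStar p)) (C : Subgroup c.G), IsCompact (C : Set c.G) →
        ∃ (v : (metabelianLeafStar p).graph.Vertex) (H : Subgroup c.G), H ∈ verticialSubgroups c v ∧ C ≤ H :=
  fun h => metabelianLeafStar_not_compactInVerticialAt p
    (((metabelianLeafStar p).compactInVerticialAt_iff_exists_verticial_of_noCore (metabelianLeafStar_noCore p)).mpr
      fun _ => h)

/-- **(R3c) HOLDS at `𝒢⋆(p)` at every chart WHILE Thm 3.7 (iii), first sentence, FAILS there, and `𝒢⋆(p)` is NOT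
locally finite** — the analogue at the rayless star of `thetaRayFreeProP_edgeLikeCentralizerAt_and_not_compactInVerticialAt`
(`ThetaRayCor39.lean`, where the LOCALLY FINITE producer did the work); here the no-core producer is needed.
[cite: MochizukiSemiAnbd2006, Cor 3.9 p.43] -/
theorem metabelianLeafStar_edgeLikeCentralizerAt_and_not_compactInVerticialAt :
    (∀ c : TemperedPiChart (metabelianLeafStar p), EdgeLikeCentralizerAt (metabelianLeafStar p) c) ∧
      ¬ CompactInVerticialAt (metabelianLeafStar p) ∧ ¬ (metabelianLeafStar p).graph.IsLocallyFinite :=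
  ⟨metabelianLeafStar_edgeLikeCentralizerAt p, metabelianLeafStar_not_compactInVerticialAt p,
    (metabelianLeafStar_isConnected_isCountable_hasVertex p).2.2.2.2⟩

/-- **The Cor-3.9-restricted form of Thm 3.7 (iii) is FALSE also in the class of graphs that are NOT locally
finite** (so neither «locally finite» nor its negation is the missing hypothesis of the ∀-countable typing):
countermodel `𝒢⋆(2)`. [cite: MochizukiSemiAnbd2006, Thm 3.7(iii) pp.40-41] -/
theorem not_forall_cor39Hypotheses_not_isLocallyFinite_compactInVerticialAt :
    ¬ ∀ ℋ : ProfiniteSemiGraph.{0}, Cor39Hypotheses ℋ → ¬ ℋ.graph.IsLocallyFinite → CompactInVerticialAt ℋ :=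
  fun h =>
  haveI : Fact (Nat.Prime 2) := ⟨Nat.prime_two⟩
  metabelianLeafStar_not_compactInVerticialAt 2
    (h _ (metabelianLeafStar_cor39Hypotheses 2) (metabelianLeafStar_isConnected_isCountable_hasVertex 2).2.2.2.2)

/-- **… and in the class of graphs WITHOUT an infinitely-branching core** (where sentences 2–3 of Thm 3.7 (iii),
the triple-conjugate criterion and (R3c) are theorems, `TemperedThm37OfNoCore.lean`): the existence sentence is not
rescued by «no core» either — countermodel `𝒢⋆(2)`. [cite: MochizukiSemiAnbd2006, Thm 3.7(iii) pp.40-41] -/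
theorem not_forall_cor39Hypotheses_noCore_compactInVerticialAt :
    ¬ ∀ ℋ : ProfiniteSemiGraph.{0}, Cor39Hypotheses ℋ →
      (∀ S : Set ℋ.graph.Vertex, S.Nonempty → ∃ w ∈ S,
        {b : ℋ.graph.Branch | ℋ.graph.abuts b = some w ∧ ∃ b', b' ≠ b ∧ ℋ.graph.edgeOf b' = ℋ.graph.edgeOf b ∧
          ∃ w' ∈ S, ℋ.graph.abuts b' = some w'}.Finite) →
      CompactInVerticialAt ℋ :=
  fun h =>
  haveI : Fact (Nat.Prime 2) := ⟨Nat.prime_two⟩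
  metabelianLeafStar_not_compactInVerticialAt 2
    (h _ (metabelianLeafStar_cor39Hypotheses 2) (metabelianLeafStar_noCore 2))

end ProfiniteSemiGraph

end Literature.AnabelianGeometry.SemiGraphs

end
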